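import Literature.Computability.QuantumComplexity.SchmidtRankApproximation
import Literature.LinearAlgebra.Matrix.RayleighQuotient
import HarnessLib

/-!
# The Schmidt decomposition EXISTS (Nielsen–Chuang Thm 2.7), in the amplitude-table vocabulary

Topic `Literature/Computability/QuantumComplexity` (companion of `TruncatedStateFidelity.lean` /
`SchmidtRankApproximation.lean`). Those files prove truncation and Eckart–Young / Ky Fan statements for a
state GIVEN in Schmidt form `ψ = Σ_k c_k a_k ⊗ b_k` (`superpose (tensorVec a b) c`, `a`, `b` orthonormal);
this file supplies the missing existence theorem: EVERY amplitude table `ψ : α × β → ℂ` on a finite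
bipartite index set has such a form, with strictly positive real coefficients whose squares are the non-zero
eigenvalues of the Gram matrix `Ψ Ψ†` (the reduced density matrix of the left block). Offered by cell qa-cr
(line L-10; it lets the tree's Schmidt-form theorems — `overlapSq_le_topMass`,
`exp_renyiEnt_mul_overlapSq_rpow_le_card` — be applied to a state handed over as amplitudes). HONEST FRAMING:
finite-dimensional linear algebra (the spectral theorem for the Hermitian matrix `Ψ Ψ†`, Mathlib's
`Matrix.IsHermitian.eigenvectorBasis`); no claim about any circuit family, cost, or complexity class.

## What the source says

[cite: NielsenChuang2010, §2.5 Theorem 2.7 (Schmidt decomposition)]: for a pure state `|ψ⟩` of a composite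
system `AB` there are orthonormal states `|i_A⟩`, `|i_B⟩` and non-negative reals `λ_i` (Schmidt
coefficients) with `|ψ⟩ = Σ_i λ_i |i_A⟩|i_B⟩` and `Σ_i λ_i² = 1` (for unit `ψ`); the proof there
(via the singular value decomposition) is replaced here by the equivalent eigen-decomposition of
`ρ_A ∝ Ψ Ψ†` [cite: NielsenChuang2010, §2.5 proof of Thm 2.7 and Ex. 2.77–2.79]: with `(u_k)` an orthonormal
eigenbasis of `Ψ Ψ†` (eigenvalues `λ_k ≥ 0`), the vectors `b̃_k = (⟨u_k| ⊗ 1)ψ` are pairwise orthogonal with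
`‖b̃_k‖² = λ_k`, and completeness of `(u_k)` gives `ψ = Σ_k u_k ⊗ b̃_k`; normalising the non-zero `b̃_k`
yields the Schmidt form on the index set `{k : λ_k ≠ 0}`.

## Contents (all proved; 0 named facts; no new definitions)

* **`exists_schmidtDecomposition`** — for every `ψ : α × β → ℂ` there are a finset `S ⊆ α`, orthonormal
  families `a : S → (α → ℂ)`, `b : S → (β → ℂ)` and reals `c : S → ℝ`, all `c k > 0`, with
  `ψ = superpose (tensorVec a b) c univ = Σ_{k∈S} c_k · a_k ⊗ b_k`, and `c_k² = λ_k(Ψ Ψ†)` (Mathlib's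
  `eigenvalues` of `Matrix.isHermitian_mul_conjTranspose_self Ψ`, `Ψ = Matrix.of ψ.curry`).
* `reduced_superpose_tensorVec` / `sum_norm_sq_reduced_superpose_tensorVec` — for a state GIVEN in Schmidt
  form, `ρ_A(a₀,a₁) = Σ_k |c_k|² a_k(a₀) conj a_k(a₁)` and `Tr ρ_A² = Σ_{a₀,a₁} |ρ_A(a₀,a₁)|² = Σ_k |c_k|⁴`
  [cite: NielsenChuang2010, §2.5, paragraph after Theorem 2.7 (`ρ^A = Σ_i λ_i² |i_A⟩⟨i_A|`)] — the bridge
  between the amplitude-table purity and the Schmidt spectrum (`Tr ρ_A² = e^{−S₂}`).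
* `exists_schmidtDecomposition_norm` — existence together with `Σ_k c_k² = Σ_p ‖ψ p‖²` (`= 1` for a unit
  state) and `Σ_{a₀,a₁} |Σ_y ψ(a₀,y) conj ψ(a₁,y)|² = Σ_k c_k⁴`
  [cite: NielsenChuang2010, §2.5 Theorem 2.7 ('Σ_i λ_i² = 1') and the paragraph after it].

Not covered: uniqueness of the coefficients up to order, the Schmidt number bound `#S ≤ min(|α|, |β|)`,
mixed states.
-/

open Finset Matrix
open scoped BigOperators ComplexConjugate

namespace Literature.Computability.QuantumComplexity

open Literature.LinearAlgebra.Matrix.RayleighQuotient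

variable {α β : Type*} [Fintype α] [Fintype β] [DecidableEq α]

/-- The coefficient matrix `Ψ(a,b) = ψ(a,b)` of an amplitude table. [folklore] -/
private def coefMat (ψ : α × β → ℂ) : Matrix α β ℂ := Matrix.of fun a b => ψ (a, b)

omit [Fintype α] [DecidableEq α] in
/-- `Ψ Ψ†` is Hermitian. [folklore] -/
private theorem isHermitian_gram (ψ : α × β → ℂ) : (coefMat ψ * (coefMat ψ)ᴴ).IsHermitian :=
  Matrix.isHermitian_mul_conjTranspose_self _

/-- The orthonormal eigenbasis `u_k` of `Ψ Ψ†`, as functions `α → ℂ`. [folklore] -/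
private noncomputable def eigVec (ψ : α × β → ℂ) (k : α) : α → ℂ := ⇑((isHermitian_gram ψ).eigenvectorBasis k)

/-- The eigenvalues `λ_k` of `Ψ Ψ†` (Mathlib's `eigenvalues`; the squared Schmidt coefficients, padded with
zeros). [folklore] -/
private noncomputable def schmidtEig (ψ : α × β → ℂ) (k : α) : ℝ := (isHermitian_gram ψ).eigenvalues k

/-- The unnormalised right vectors `b̃_k = (⟨u_k| ⊗ 1)ψ`. [folklore] -/
private noncomputable def rawRight (ψ : α × β → ℂ) (k : α) : β → ℂ := contractLeft (eigVec ψ k) ψ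

/-- `⟨u_k|u_l⟩ = δ_kl`. [folklore] -/
private theorem braket_eigVec (ψ : α × β → ℂ) (k l : α) :
    braket (eigVec ψ k) (eigVec ψ l) = if k = l then 1 else 0 := by
  rw [← star_eigenvectorBasis_dotProduct (isHermitian_gram ψ) k l]
  rfl

/-- Completeness of the eigenbasis: `Σ_k u_k(a) · conj u_k(a') = δ_{a a'}` (from `U U† = 1` for Mathlib's
`eigenvectorUnitary`). [folklore] -/
private theorem sum_eigVec_mul_conj (ψ : α × β → ℂ) (a a' : α) :
    ∑ k, eigVec ψ k a * conj (eigVec ψ k a') = if a = a' then 1 else 0 := by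
  have hU := Matrix.mem_unitaryGroup_iff.mp (isHermitian_gram ψ).eigenvectorUnitary.2
  have h := congrFun (congrFun hU a) a'
  rw [Matrix.mul_apply, Matrix.one_apply] at h
  rw [← h]
  refine sum_congr rfl fun k _ => ?_
  rw [Matrix.star_apply, (isHermitian_gram ψ).eigenvectorUnitary_apply,
    (isHermitian_gram ψ).eigenvectorUnitary_apply]
  rfl

/-- The expansion `ψ(a,b) = Σ_k u_k(a) · b̃_k(b)`. [folklore] -/
private theorem sum_eigVec_mul_rawRight (ψ : α × β → ℂ) (a : α) (b : β) :
    ∑ k, eigVec ψ k a * rawRight ψ k b = ψ (a, b) := by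
  unfold rawRight contractLeft
  simp_rw [mul_sum]
  rw [sum_comm]
  calc ∑ a', ∑ k, eigVec ψ k a * (conj (eigVec ψ k a') * ψ (a', b))
      = ∑ a', (∑ k, eigVec ψ k a * conj (eigVec ψ k a')) * ψ (a', b) := by
        refine sum_congr rfl fun a' _ => ?_
        rw [sum_mul]
        exact sum_congr rfl fun k _ => by ring
    _ = ψ (a, b) := by
        simp_rw [sum_eigVec_mul_conj, ite_mul, one_mul, zero_mul]
        rw [sum_ite_eq univ a, if_pos (mem_univ a)]

/-- Both `⟨b̃_k|b̃_l⟩` and `u_l† (Ψ Ψ†) u_k` equal the same triple sum. [folklore] -/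
private theorem braket_rawRight_eq_dotProduct (ψ : α × β → ℂ) (k l : α) :
    braket (rawRight ψ k) (rawRight ψ l) =
      star (eigVec ψ l) ⬝ᵥ ((coefMat ψ * (coefMat ψ)ᴴ) *ᵥ eigVec ψ k) := by
  -- canonical form: Σ_b Σ_a Σ_a' (u_k a · conj ψ(a,b)) · (conj(u_l a') · ψ(a',b))
  have hL : braket (rawRight ψ k) (rawRight ψ l) =
      ∑ b, ∑ a, ∑ a', eigVec ψ k a * conj (ψ (a, b)) * (conj (eigVec ψ l a') * ψ (a', b)) := by
    unfold braket rawRight contractLeft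
    refine sum_congr rfl fun b _ => ?_
    rw [map_sum, sum_mul]
    refine sum_congr rfl fun a _ => ?_
    rw [map_mul, Complex.conj_conj, mul_sum]
  have hR : star (eigVec ψ l) ⬝ᵥ ((coefMat ψ * (coefMat ψ)ᴴ) *ᵥ eigVec ψ k) =
      ∑ a', ∑ a, ∑ b, eigVec ψ k a * conj (ψ (a, b)) * (conj (eigVec ψ l a') * ψ (a', b)) := by
    unfold dotProduct Matrix.mulVec dotProduct
    refine sum_congr rfl fun a' _ => ?_
    rw [Pi.star_apply, mul_sum]
    refine sum_congr rfl fun a _ => ?_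
    dsimp only
    rw [Matrix.mul_apply, sum_mul, mul_sum]
    refine sum_congr rfl fun b _ => ?_
    rw [Matrix.conjTranspose_apply]
    simp only [coefMat, Matrix.of_apply, Complex.star_def]
    ring
  rw [hL, hR]
  calc ∑ b, ∑ a, ∑ a', eigVec ψ k a * conj (ψ (a, b)) * (conj (eigVec ψ l a') * ψ (a', b))
      = ∑ a, ∑ b, ∑ a', eigVec ψ k a * conj (ψ (a, b)) * (conj (eigVec ψ l a') * ψ (a', b)) := sum_comm
    _ = ∑ a, ∑ a', ∑ b, eigVec ψ k a * conj (ψ (a, b)) * (conj (eigVec ψ l a') * ψ (a', b)) :=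
        sum_congr rfl fun a _ => sum_comm
    _ = ∑ a', ∑ a, ∑ b, eigVec ψ k a * conj (ψ (a, b)) * (conj (eigVec ψ l a') * ψ (a', b)) := sum_comm

/-- The Gram relations `⟨b̃_k|b̃_l⟩ = λ_k δ_kl` (eigen-equation `Ψ Ψ† u_k = λ_k u_k` and orthonormality).
[folklore] -/
private theorem braket_rawRight (ψ : α × β → ℂ) (k l : α) :
    braket (rawRight ψ k) (rawRight ψ l) = if k = l then ((schmidtEig ψ k : ℝ) : ℂ) else 0 := by
  rw [braket_rawRight_eq_dotProduct]
  change star (eigVec ψ l) ⬝ᵥ ((coefMat ψ * (coefMat ψ)ᴴ) *ᵥ ⇑((isHermitian_gram ψ).eigenvectorBasis k)) = _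
  rw [mulVec_eigenvectorBasis_eq_coe_smul (isHermitian_gram ψ) k, dotProduct_smul, smul_eq_mul]
  change _ * braket (eigVec ψ l) (eigVec ψ k) = _
  rw [braket_eigVec]
  by_cases hkl : k = l
  · subst hkl; simp [schmidtEig]
  · rw [if_neg (Ne.symm hkl), if_neg hkl, mul_zero]

/-- `‖b̃_k‖² = λ_k`; in particular the eigenvalues of `Ψ Ψ†` are `≥ 0`. [folklore] -/
private theorem sum_norm_sq_rawRight (ψ : α × β → ℂ) (k : α) :
    ∑ b, ‖rawRight ψ k b‖ ^ 2 = schmidtEig ψ k := by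
  have h := braket_rawRight ψ k k
  rw [if_pos rfl, braket_self] at h
  exact_mod_cast h

/-- `b̃_k = 0` when `λ_k = 0`. [folklore] -/
private theorem rawRight_eq_zero (ψ : α × β → ℂ) {k : α} (hk : schmidtEig ψ k = 0) :
    rawRight ψ k = 0 := by
  have h := sum_norm_sq_rawRight ψ k
  rw [hk] at h
  funext b
  have hb := (sum_eq_zero_iff_of_nonneg (fun b _ => sq_nonneg ‖rawRight ψ k b‖)).mp h b (mem_univ b)
  exact norm_eq_zero.mp (pow_eq_zero_iff two_ne_zero |>.mp hb)

/-! ### Reduced density matrix and purity of a state given in Schmidt form -/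

section SchmidtForm

variable {κ : Type*} [Fintype κ] [DecidableEq κ]

omit [Fintype α] [DecidableEq α] in
/-- **The reduced density matrix of a Schmidt-form state is diagonal in the Schmidt basis**:
for `ψ = Σ_k c_k a_k ⊗ b_k` with `a`, `b` orthonormal, `ρ_A(ψ)(a₀,a₁) = Σ_y ψ(a₀,y) conj ψ(a₁,y)
= Σ_k |c_k|² a_k(a₀) conj a_k(a₁)` ('`ρ^A = Σ_i λ_i² |i_A⟩⟨i_A|`, so the eigenvalues of `ρ^A` are `λ_i²`').
[cite: NielsenChuang2010, §2.5, paragraph after Theorem 2.7 (`ρ^A = Σ_i λ_i² |i_A⟩⟨i_A|`)] -/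
theorem reduced_superpose_tensorVec {a : κ → α → ℂ} {b : κ → β → ℂ} (hb : IsOrthonormalFamily b)
    (c : κ → ℂ) (a₀ a₁ : α) :
    ∑ y, superpose (fun k => tensorVec (a k) (b k)) c univ (a₀, y) *
        conj (superpose (fun k => tensorVec (a k) (b k)) c univ (a₁, y))
      = ∑ k, ((‖c k‖ ^ 2 : ℝ) : ℂ) * (a k a₀ * conj (a k a₁)) := by
  unfold superpose tensorVec
  dsimp only
  -- expand: Σ_y Σ_k Σ_l c_k a_k(a₀) b_k(y) · conj(c_l a_l(a₁) b_l(y))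
  calc ∑ y, (∑ k, c k * (a k a₀ * b k y)) * conj (∑ l, c l * (a l a₁ * b l y))
      = ∑ y, ∑ k, ∑ l, c k * a k a₀ * (conj (c l) * conj (a l a₁)) * (b k y * conj (b l y)) := by
        refine sum_congr rfl fun y _ => ?_
        rw [map_sum, sum_mul]
        refine sum_congr rfl fun k _ => ?_
        rw [mul_sum]
        refine sum_congr rfl fun l _ => ?_
        rw [map_mul, map_mul]; ring
    _ = ∑ k, ∑ l, c k * a k a₀ * (conj (c l) * conj (a l a₁)) * ∑ y, b k y * conj (b l y) := by
        rw [sum_comm]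
        refine sum_congr rfl fun k _ => ?_
        rw [sum_comm]
        refine sum_congr rfl fun l _ => ?_
        rw [mul_sum]
    _ = ∑ k, ∑ l, c k * a k a₀ * (conj (c l) * conj (a l a₁)) * (if l = k then 1 else 0) := by
        refine sum_congr rfl fun k _ => sum_congr rfl fun l _ => ?_
        congr 1
        rw [← hb l k]
        unfold braket
        exact sum_congr rfl fun y _ => mul_comm _ _
    _ = ∑ k, ((‖c k‖ ^ 2 : ℝ) : ℂ) * (a k a₀ * conj (a k a₁)) := by
        refine sum_congr rfl fun k _ => ?_
        simp_rw [mul_ite, mul_one, mul_zero]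
        rw [sum_ite_eq' univ k, if_pos (mem_univ k), ← Complex.normSq_eq_norm_sq, ← Complex.mul_conj]
        ring

omit [Fintype κ] [DecidableEq α] in
/-- The entrywise conjugate of an orthonormal family is orthonormal. [folklore] -/
private theorem isOrthonormalFamily_conj {a : κ → α → ℂ} (ha : IsOrthonormalFamily a) :
    IsOrthonormalFamily (fun k i => conj (a k i)) := by
  intro k l
  have h := ha l k
  unfold braket at h ⊢
  simp_rw [Complex.conj_conj]
  rw [show (∑ i, a k i * conj (a l i)) = ∑ i, conj (a l i) * a k i from
    sum_congr rfl fun i _ => mul_comm _ _, h]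
  by_cases hkl : k = l
  · subst hkl; rfl
  · rw [if_neg hkl, if_neg (Ne.symm hkl)]

omit [DecidableEq α] in
/-- **Purity of the left block from the Schmidt coefficients**: for `ψ = Σ_k c_k a_k ⊗ b_k` with `a`, `b`
orthonormal, `Tr ρ_A(ψ)² = Σ_{a₀,a₁} |ρ_A(ψ)(a₀,a₁)|² = Σ_k |c_k|⁴` (`= Σ_i λ_i⁴` in the notation
`λ_i = |c_i|`; `= e^{−S₂}`). [cite: NielsenChuang2010, §2.5, paragraph after Theorem 2.7 ('the eigenvalues of
`ρ^A` are `λ_i²`')] [cite: SchuchEtAl2008, display `S_α(ρ) = log tr ρ^α / (1 − α)` (α = 2)] -/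
theorem sum_norm_sq_reduced_superpose_tensorVec {a : κ → α → ℂ} {b : κ → β → ℂ}
    (ha : IsOrthonormalFamily a) (hb : IsOrthonormalFamily b) (c : κ → ℂ) :
    ∑ a₀, ∑ a₁, ‖∑ y, superpose (fun k => tensorVec (a k) (b k)) c univ (a₀, y) *
        conj (superpose (fun k => tensorVec (a k) (b k)) c univ (a₁, y))‖ ^ 2 = ∑ k, ‖c k‖ ^ 4 := by
  simp_rw [reduced_superpose_tensorVec hb c]
  -- (a₀,a₁) ↦ Σ_k |c_k|² a_k(a₀) conj a_k(a₁) is the superposition of the orthonormal a_k ⊗ conj a_k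
  have hW := isOrthonormalFamily_tensorVec ha (isOrthonormalFamily_conj ha)
  have h := sum_norm_sq_superpose hW (fun k => ((‖c k‖ ^ 2 : ℝ) : ℂ)) univ
  rw [Fintype.sum_prod_type] at h
  unfold superpose tensorVec at h
  dsimp only at h
  rw [h, keptWeight]
  refine sum_congr rfl fun k _ => ?_
  rw [Complex.norm_real, Real.norm_of_nonneg (sq_nonneg _)]
  ring

end SchmidtForm

/-! ### Existence -/

/-- **Schmidt decomposition — existence.** For every amplitude table `ψ : α × β → ℂ` on a finite bipartite
index set there are a finset `S` of indices, ORTHONORMAL families `a : S → (α → ℂ)` and `b : S → (β → ℂ)`,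
and STRICTLY POSITIVE reals `c : S → ℝ` with `ψ = Σ_{k ∈ S} c_k · a_k ⊗ b_k`
(`= superpose (tensorVec a b) c univ` in the vocabulary of `TruncatedStateFidelity` /
`SchmidtRankApproximation`),
and `c_k²` is the `k`-th eigenvalue of the Gram matrix `Ψ Ψ†`, `Ψ = (ψ(a,b))_{a,b}` (the unnormalised reduced
density matrix of the left block). [cite: NielsenChuang2010, §2.5 Theorem 2.7 (Schmidt decomposition)] -/
theorem exists_schmidtDecomposition (ψ : α × β → ℂ) :
    ∃ (S : Finset α) (a : ↥S → α → ℂ) (b : ↥S → β → ℂ) (c : ↥S → ℝ),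
      IsOrthonormalFamily a ∧ IsOrthonormalFamily b ∧ (∀ k, 0 < c k) ∧
      (∀ k, c k ^ 2 = (Matrix.isHermitian_mul_conjTranspose_self
          (Matrix.of fun a b => ψ (a, b) : Matrix α β ℂ)).eigenvalues k.1) ∧
      ψ = superpose (fun k => tensorVec (a k) (b k)) (fun k => (c k : ℂ)) univ := by
  have hlam0 : ∀ k, 0 ≤ schmidtEig ψ k := fun k => by
    rw [← sum_norm_sq_rawRight ψ k]; exact sum_nonneg fun b _ => sq_nonneg _
  set S : Finset α := univ.filter fun k => schmidtEig ψ k ≠ 0 with hS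
  have hSpos : ∀ k : ↥S, 0 < schmidtEig ψ k.1 := fun k =>
    lt_of_le_of_ne (hlam0 k.1) (Ne.symm ((mem_filter.mp k.2).2))
  set c : ↥S → ℝ := fun k => Real.sqrt (schmidtEig ψ k.1) with hc
  have hcpos : ∀ k, 0 < c k := fun k => Real.sqrt_pos.mpr (hSpos k)
  have hcsq : ∀ k, c k ^ 2 = schmidtEig ψ k.1 := fun k => Real.sq_sqrt (hlam0 k.1)
  set a : ↥S → α → ℂ := fun k => eigVec ψ k.1 with ha
  set b : ↥S → β → ℂ := fun k x => ((c k)⁻¹ : ℝ) * rawRight ψ k.1 x with hb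
  refine ⟨S, a, b, c, ?_, ?_, hcpos, fun k => hcsq k, ?_⟩
  · -- a orthonormal
    intro k l
    rw [ha]; dsimp only
    rw [braket_eigVec]
    by_cases hkl : k = l
    · subst hkl; simp
    · rw [if_neg hkl, if_neg (fun h => hkl (Subtype.ext h))]
  · -- b orthonormal
    intro k l
    have hbr : braket (b k) (b l) =
        ((c k)⁻¹ : ℝ) * ((c l)⁻¹ : ℝ) * braket (rawRight ψ k.1) (rawRight ψ l.1) := by
      rw [hb]; unfold braket; dsimp only
      rw [mul_sum]
      exact sum_congr rfl fun x _ => by rw [map_mul, Complex.conj_ofReal]; ring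
    rw [hbr, braket_rawRight]
    by_cases hkl : k = l
    · subst hkl
      rw [if_pos rfl, if_pos rfl, ← hcsq k]
      have hck : (c k : ℂ) ≠ 0 := by exact_mod_cast (hcpos k).ne'
      push_cast
      field_simp
    · rw [if_neg (fun h => hkl (Subtype.ext h)), if_neg hkl, mul_zero]
  · -- the expansion
    funext p
    obtain ⟨x, y⟩ := p
    unfold superpose tensorVec
    dsimp only
    rw [← sum_eigVec_mul_rawRight ψ x y]
    -- Σ_{k : S} c_k (u_k x · c_k⁻¹ b̃_k y) = Σ_{k ∈ S} u_k x · b̃_k y = Σ_k u_k x · b̃_k y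
    have h1 : ∑ k : ↥S, (c k : ℂ) * (a k x * b k y) = ∑ k ∈ S, eigVec ψ k x * rawRight ψ k y := by
      rw [← sum_coe_sort S]
      refine sum_congr rfl fun k _ => ?_
      rw [ha, hb]; dsimp only
      have hck : (c k : ℂ) ≠ 0 := by exact_mod_cast (hcpos k).ne'
      push_cast
      field_simp
    rw [h1, hS, sum_filter]
    refine sum_congr rfl fun k _ => ?_
    by_cases hk : schmidtEig ψ k = 0
    · rw [if_neg (not_not.mpr hk), rawRight_eq_zero ψ hk, Pi.zero_apply, mul_zero]
    · rw [if_pos hk]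

/-- **Schmidt decomposition with the spectral identities**: `Σ_{k∈S} c_k² = Σ_p ‖ψ p‖²` (`= 1` for a unit
state: 'the Schmidt coefficients satisfy `Σ_i λ_i² = 1`') and
`Tr ρ_A(ψ)² = Σ_{a₀,a₁} |Σ_y ψ(a₀,y) conj ψ(a₁,y)|² = Σ_{k∈S} c_k⁴` (the purity of the left block is the 4th
power sum of the Schmidt coefficients).
[cite: NielsenChuang2010, §2.5 Theorem 2.7 (`Σ_i λ_i² = 1`) and the paragraph after it (`ρ^A = Σ_i λ_i²
|i_A⟩⟨i_A|`)] -/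
theorem exists_schmidtDecomposition_norm (ψ : α × β → ℂ) :
    ∃ (S : Finset α) (a : ↥S → α → ℂ) (b : ↥S → β → ℂ) (c : ↥S → ℝ),
      IsOrthonormalFamily a ∧ IsOrthonormalFamily b ∧ (∀ k, 0 < c k) ∧
      ∑ k, c k ^ 2 = ∑ p, ‖ψ p‖ ^ 2 ∧
      ∑ a₀, ∑ a₁, ‖∑ y, ψ (a₀, y) * conj (ψ (a₁, y))‖ ^ 2 = ∑ k, c k ^ 4 ∧
      ψ = superpose (fun k => tensorVec (a k) (b k)) (fun k => (c k : ℂ)) univ := by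
  obtain ⟨S, a, b, c, ha, hb, hc, -, hψ⟩ := exists_schmidtDecomposition ψ
  refine ⟨S, a, b, c, ha, hb, hc, ?_, ?_, hψ⟩
  · have h := sum_norm_sq_superpose (isOrthonormalFamily_tensorVec ha hb) (fun k => (c k : ℂ)) univ
    rw [← hψ, keptWeight] at h
    rw [h]
    exact sum_congr rfl fun k _ => by rw [Complex.norm_real, Real.norm_eq_abs, sq_abs]
  · rw [hψ, sum_norm_sq_reduced_superpose_tensorVec ha hb]
    exact sum_congr rfl fun k _ => by
      rw [Complex.norm_real, Real.norm_eq_abs, show (4 : ℕ) = 2 * 2 from rfl, pow_mul, sq_abs, ← pow_mul]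

end Literature.Computability.QuantumComplexity
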